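import Mathlib

/-!
# SoloBlind — grid + Lipschitz lower bound (zero-freeness of the dressed pair scalar, ENGINE P)

`pairscalar.py` certifies that the dressed pair scalar `𝔇 = P + E` (Taylor polynomial `P` plus a
remainder `‖E‖ ≤ R`) has no zero on a region `S` of the `(x, g)` box: it evaluates `P` on a finite
set of nodes `N` which covers `S` within `(ρX, ρG)` for two "distance" functions, uses Lipschitz
constants `LX, LG` of `P`, and checks `m - LX ρX - LG ρG - R > 0` where `m ≤ ‖P y‖` at every node.
This file is the (elementary, metric-free) logic of that certificate:

* `norm_lower_of_cover`     : `m - LX ρX - LG ρG ≤ ‖P x‖` on `S`;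
* `ne_zero_of_cover`        : with `‖E x‖ ≤ R` and `m - LX ρX - LG ρG - R > 0`, `P x + E x ≠ 0` on `S`.
-/

namespace Summit.AnomalousDissipation.SoloBlind.GridLowerBound

variable {α : Type*}

/-- Covering + Lipschitz ⇒ a lower bound for `‖P ·‖` on the covered set. -/
theorem norm_lower_of_cover (P : α → ℂ) (S : Set α) (N : Finset α)
    (dX dG : α → α → ℝ) {LX LG ρX ρG m : ℝ} (hLX : 0 ≤ LX) (hLG : 0 ≤ LG)
    (hlip : ∀ x ∈ S, ∀ y ∈ N, ‖P x - P y‖ ≤ LX * dX x y + LG * dG x y)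
    (hcov : ∀ x ∈ S, ∃ y ∈ N, dX x y ≤ ρX ∧ dG x y ≤ ρG)
    (hm : ∀ y ∈ N, m ≤ ‖P y‖) :
    ∀ x ∈ S, m - LX * ρX - LG * ρG ≤ ‖P x‖ := by
  intro x hx
  obtain ⟨y, hyN, hdx, hdg⟩ := hcov x hx
  have h1 : ‖P y‖ - ‖P x - P y‖ ≤ ‖P x‖ := by
    have := norm_sub_norm_le (P y) (P x)
    have h' : ‖P y - P x‖ = ‖P x - P y‖ := norm_sub_rev _ _
    linarith
  have h2 : ‖P x - P y‖ ≤ LX * ρX + LG * ρG := by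
    refine (hlip x hx y hyN).trans ?_
    gcongr
  linarith [hm y hyN]

/-- Zero-freeness of `P + E` on the covered set. -/
theorem ne_zero_of_cover (P E : α → ℂ) (S : Set α) (N : Finset α)
    (dX dG : α → α → ℝ) {LX LG ρX ρG m R : ℝ} (hLX : 0 ≤ LX) (hLG : 0 ≤ LG)
    (hlip : ∀ x ∈ S, ∀ y ∈ N, ‖P x - P y‖ ≤ LX * dX x y + LG * dG x y)
    (hcov : ∀ x ∈ S, ∃ y ∈ N, dX x y ≤ ρX ∧ dG x y ≤ ρG)
    (hm : ∀ y ∈ N, m ≤ ‖P y‖) (hE : ∀ x ∈ S, ‖E x‖ ≤ R)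
    (hpos : 0 < m - LX * ρX - LG * ρG - R) :
    ∀ x ∈ S, P x + E x ≠ 0 ∧ m - LX * ρX - LG * ρG - R ≤ ‖P x + E x‖ := by
  intro x hx
  have hP := norm_lower_of_cover P S N dX dG hLX hLG hlip hcov hm x hx
  have hlow : m - LX * ρX - LG * ρG - R ≤ ‖P x + E x‖ := by
    have := norm_sub_norm_le (P x) (-(E x))
    have h' : ‖P x - -E x‖ = ‖P x + E x‖ := by rw [sub_neg_eq_add]
    rw [norm_neg] at this
    linarith [hE x hx]
  refine ⟨fun h0 => ?_, hlow⟩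
  rw [h0, norm_zero] at hlow
  linarith

end Summit.AnomalousDissipation.SoloBlind.GridLowerBound
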